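import Summits.MatrixMultiplication.MatrixMultiplication.Theorems.ObstructionDescentBlockAction
import Summits.MatrixMultiplication.MatrixMultiplication.Theorems.ObstructionDescentWitnessPoints
import Summits.MatrixMultiplication.MatrixMultiplication.Theorems.ObstructionDescentLeviWeylLaw

set_option linter.dupNamespace false

/-!
# Obstruction descent — the Levi RESTRICTION law for block points (decomp-mm · lens 3 · gen 14, law H13, Part B)

Route `route-MatrixMultiplication-ObstructionDescent` (sub-problem `MatrixMultiplication`, `ω(ℂ) = 2`), rev 7 `3f9f51b758cc`;
support for the aside **`InvariantSaturation`** (item `stmt-MatrixMultiplication-32282`, the invariant tower) and its linear-scale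
form **`BlockLinearSaturation`** (item `stmt-MatrixMultiplication-33327`).  Imports Part A (`ObstructionDescentBlockAction`:
`mixT`, `cubeLast`, `blockDiag`, `restrictB`, `extendLast` and their calculus), the LANDED witness-point file and the Levi–Weyl
law H12 (`ObstructionDescentLeviWeylLaw`); restates no item.

## What is proved

Fix a format `m`, a corner size `N` and a sub-block size `N₂ ≤ N`; write `B = {i | m ≤ i + N₂}` for the LAST `N₂` indices
(so `B` sits inside the corner `{i | m ≤ i + N}`) and `B³` for the cube of index triples all in `B`.  A tensor `x` is
BLOCK-DIAGONAL for `B` (`x ∈ blockDiag m N₂`) when each non-zero entry has its three indices all in `B` or all outside `B` — the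
shape `x = x_out ⊞ x_B` of the block points of the census (direct sums `w₁ ⊕ ⋯ ⊕ w_r` padded into the corner, grouped as
«last block» against «the rest»).

* **H13 (Levi restriction law, `restrictB_mem_hwvSpace`).**  For a weight vector `f` of the rectangular type `((k^N))³` (level `k`
  of the corner) and a block-diagonal `x`, the PARTIAL EVALUATION `y ↦ f(x_out ⊞ y|_{B³})` (`restrictB N₂ x f`, an explicit algebra
  endomorphism of `ℂ[ℂ^m ⊗ ℂ^m ⊗ ℂ^m]`) is a weight vector of type `((k^{N₂}))³` in degree `k·N₂` — a level-`k` vector OF THE BLOCK.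
  Mechanism: a Borel triple `(P,Q,R)` acting on `y` is, on `x_out ⊞ y|_{B³}`, the action of the block-extended Borel triple
  `(1 ⊕ P_BB, 1 ⊕ Q_BB, 1 ⊕ R_BB)` (`mixT_actTensor`; upper-triangularity makes the `B`-rows of `P` see only `B`-columns, and
  block-diagonality of `x` kills the cross terms), whose `((k^N))³`-character is the `((k^{N₂}))³`-character of `(P,Q,R)`
  (`weightChar_rectType_extendLast`); homogeneity of the restriction in the right degree is READ OFF the scalar torus
  (`isHomogeneous_of_eval_smul_ne_zero`, a general lemma: `g(s·y) = s^d g(y)` for all `s ≠ 0` forces `g` homogeneous of degree `d`).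
* **Levels of block points (`pointLevels_subset_pointLevels_last`, `…_cubeLast`).**  Hence every level of a block-diagonal point is
  a level of its last block: `E'_N(x_out ⊞ x_B) ⊆ E'_{N₂}(x_B)` — the NECESSITY half of the dead-window law H11(a) of the hand
  notes (gen 11–12): a window `(N₁,…,N_r)` can carry level `k` only if `k` is a level of every block at its own format; in
  particular (`not_mem_pointLevels_of_emptyLevel_last`) a block of a size `N₂` at which level `k` is EMPTY (e.g. `N₂ = 2` at every
  odd `k`, `N₂ = 4` at `k = 1`, by the hand tables) kills the window outright.
* **Window law (`pointLevels_subset_pointLevels_window`, `not_mem_pointLevels_of_emptyLevel_window`).**  Combined with the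
  corner-relabelling invariance of levels (H12 (D₃), three slots at once: `pointLevels_actTensor_permMatrix`) the block need not be
  the last one: if a corner relabelling `σ` makes `σ·x` block-diagonal for the last `N₂`, then `E'_N(x) ⊆ E'_{N₂}((σ·x)|_{B³})`,
  and an empty level of the format `N₂` is not a level of `x`.
* **Lifting inequality (`pointLevels_add_subset_passLevels`).**  Conversely a level carried by a block point whose block ranks sum
  to `≤ m` passes at `m` (witness principle of the tower file + subadditivity of rank): the sufficiency half used by every census
  certificate `r_N(k) ≤ R(w₁) + ⋯ + R(w_r)`.

Together: the levels of the block points — the only witnesses the programme has below the matrix multiplication tensor itself —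
are computed FROM THE BLOCKS up to the lifting law (which block levels survive in the sum), and the kernel now owns both the
format-raising map (`liftPoly`, level-monoid file) and the format-lowering map (`restrictB`, this file) between the towers of
different formats.  All statements over `ℂ`; no `sorry`; standard axioms.
[cite: BurgisserIkenmeyer2017, §5 (5.2), Thm 5.3 (exponent monoid of a point); BurgisserIkenmeyer2011, §3.1–3.2 (weight vectors)]
-/

noncomputable section

open scoped BigOperators
open Finset

namespace Summit.MatrixMultiplication.MatrixMultiplication.Theorems.ObstructionCalculus

open Literature.Computability.AlgebraicComplexity (tensorRank actTensor actTensor_apply actTensor_actTensor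
  tensorRank_add_le)

section BlockRestriction

variable {m : ℕ}

/-! ### 2 · The block-extended Borel action on mixed tensors -/

/-- Slot `2`: the block-extended action on a mixed tensor is the mixed tensor of the action. [this node] -/
theorem slotAct_two_extendLast_mixT {N₂ : ℕ} {x : Tensor ℂ m} (hx : x ∈ blockDiag m N₂)
    {R : Matrix (Fin m) (Fin m) ℂ} (hR : R ∈ borel m) (y : Tensor ℂ m) :
    slotAct 2 (extendLast N₂ R) (mixT N₂ x y) = mixT N₂ x (slotAct 2 R y) := by
  funext a b c
  rw [slotAct_two_apply]
  by_cases hc : m ≤ (c : ℕ) + N₂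
  · simp only [extendLast_apply_of_mem R hc]
    by_cases hab : m ≤ (a : ℕ) + N₂ ∧ m ≤ (b : ℕ) + N₂
    · rw [show mixT N₂ x (slotAct 2 R y) a b c = ∑ c', R c c' * y a b c' by
        simp only [mixT, if_pos (And.intro hab.1 (And.intro hab.2 hc)), slotAct_two_apply]]
      refine Finset.sum_congr rfl fun c' _ => ?_
      by_cases hc' : m ≤ (c' : ℕ) + N₂
      · simp only [mixT, if_pos (And.intro hab.1 (And.intro hab.2 hc'))]
      · rw [borel_apply_eq_zero_of_blocks hR hc hc', zero_mul, zero_mul]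
    · have hnot : ¬ (m ≤ (a : ℕ) + N₂ ∧ m ≤ (b : ℕ) + N₂ ∧ m ≤ (c : ℕ) + N₂) := fun h => hab ⟨h.1, h.2.1⟩
      rw [show mixT N₂ x (slotAct 2 R y) a b c = x a b c by simp only [mixT, if_neg hnot],
        apply_eq_zero_of_mem_blockDiag hx (by tauto)]
      refine Finset.sum_eq_zero fun c' _ => ?_
      by_cases hc' : m ≤ (c' : ℕ) + N₂
      · have hnot' : ¬ (m ≤ (a : ℕ) + N₂ ∧ m ≤ (b : ℕ) + N₂ ∧ m ≤ (c' : ℕ) + N₂) :=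
          fun h => hab ⟨h.1, h.2.1⟩
        have h1 : mixT N₂ x y a b c' = x a b c' := by simp only [mixT, if_neg hnot']
        rw [h1, apply_eq_zero_of_mem_blockDiag hx (by tauto), mul_zero]
      · rw [borel_apply_eq_zero_of_blocks hR hc hc', zero_mul]
  · simp only [extendLast_apply_of_not_mem R hc]
    rw [Finset.sum_eq_single c]
    · have hnot : ¬ (m ≤ (a : ℕ) + N₂ ∧ m ≤ (b : ℕ) + N₂ ∧ m ≤ (c : ℕ) + N₂) := fun h => hc h.2.2
      rw [if_pos rfl, one_mul]
      simp only [mixT, if_neg hnot]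
    · intro c' _ hc'
      rw [if_neg (Ne.symm hc'), zero_mul]
    · intro h
      exact absurd (Finset.mem_univ c) h

/-- Slot `1`: the block-extended action on a mixed tensor is the mixed tensor of the action. [this node] -/
theorem slotAct_one_extendLast_mixT {N₂ : ℕ} {x : Tensor ℂ m} (hx : x ∈ blockDiag m N₂)
    {Q : Matrix (Fin m) (Fin m) ℂ} (hQ : Q ∈ borel m) (y : Tensor ℂ m) :
    slotAct 1 (extendLast N₂ Q) (mixT N₂ x y) = mixT N₂ x (slotAct 1 Q y) := by
  funext a b c
  rw [slotAct_one_apply]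
  by_cases hb : m ≤ (b : ℕ) + N₂
  · simp only [extendLast_apply_of_mem Q hb]
    by_cases hac : m ≤ (a : ℕ) + N₂ ∧ m ≤ (c : ℕ) + N₂
    · rw [show mixT N₂ x (slotAct 1 Q y) a b c = ∑ b', Q b b' * y a b' c by
        simp only [mixT, if_pos (And.intro hac.1 (And.intro hb hac.2)), slotAct_one_apply]]
      refine Finset.sum_congr rfl fun b' _ => ?_
      by_cases hb' : m ≤ (b' : ℕ) + N₂
      · simp only [mixT, if_pos (And.intro hac.1 (And.intro hb' hac.2))]
      · rw [borel_apply_eq_zero_of_blocks hQ hb hb', zero_mul, zero_mul]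
    · have hnot : ¬ (m ≤ (a : ℕ) + N₂ ∧ m ≤ (b : ℕ) + N₂ ∧ m ≤ (c : ℕ) + N₂) := fun h => hac ⟨h.1, h.2.2⟩
      rw [show mixT N₂ x (slotAct 1 Q y) a b c = x a b c by simp only [mixT, if_neg hnot],
        apply_eq_zero_of_mem_blockDiag hx (by tauto)]
      refine Finset.sum_eq_zero fun b' _ => ?_
      by_cases hb' : m ≤ (b' : ℕ) + N₂
      · have hnot' : ¬ (m ≤ (a : ℕ) + N₂ ∧ m ≤ (b' : ℕ) + N₂ ∧ m ≤ (c : ℕ) + N₂) :=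
          fun h => hac ⟨h.1, h.2.2⟩
        have h1 : mixT N₂ x y a b' c = x a b' c := by simp only [mixT, if_neg hnot']
        rw [h1, apply_eq_zero_of_mem_blockDiag hx (by tauto), mul_zero]
      · rw [borel_apply_eq_zero_of_blocks hQ hb hb', zero_mul]
  · simp only [extendLast_apply_of_not_mem Q hb]
    rw [Finset.sum_eq_single b]
    · have hnot : ¬ (m ≤ (a : ℕ) + N₂ ∧ m ≤ (b : ℕ) + N₂ ∧ m ≤ (c : ℕ) + N₂) := fun h => hb h.2.1
      rw [if_pos rfl, one_mul]
      simp only [mixT, if_neg hnot]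
    · intro b' _ hb'
      rw [if_neg (Ne.symm hb'), zero_mul]
    · intro h
      exact absurd (Finset.mem_univ b) h

/-- Slot `0`: the block-extended action on a mixed tensor is the mixed tensor of the action. [this node] -/
theorem slotAct_zero_extendLast_mixT {N₂ : ℕ} {x : Tensor ℂ m} (hx : x ∈ blockDiag m N₂)
    {P : Matrix (Fin m) (Fin m) ℂ} (hP : P ∈ borel m) (y : Tensor ℂ m) :
    slotAct 0 (extendLast N₂ P) (mixT N₂ x y) = mixT N₂ x (slotAct 0 P y) := by
  funext a b c
  rw [slotAct_zero_apply]
  by_cases ha : m ≤ (a : ℕ) + N₂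
  · simp only [extendLast_apply_of_mem P ha]
    by_cases hbc : m ≤ (b : ℕ) + N₂ ∧ m ≤ (c : ℕ) + N₂
    · rw [show mixT N₂ x (slotAct 0 P y) a b c = ∑ a', P a a' * y a' b c by
        simp only [mixT, if_pos (And.intro ha hbc), slotAct_zero_apply]]
      refine Finset.sum_congr rfl fun a' _ => ?_
      by_cases ha' : m ≤ (a' : ℕ) + N₂
      · simp only [mixT, if_pos (And.intro ha' hbc)]
      · rw [borel_apply_eq_zero_of_blocks hP ha ha', zero_mul, zero_mul]
    · have hnot : ¬ (m ≤ (a : ℕ) + N₂ ∧ m ≤ (b : ℕ) + N₂ ∧ m ≤ (c : ℕ) + N₂) := fun h => hbc h.2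
      rw [show mixT N₂ x (slotAct 0 P y) a b c = x a b c by simp only [mixT, if_neg hnot],
        apply_eq_zero_of_mem_blockDiag hx (by tauto)]
      refine Finset.sum_eq_zero fun a' _ => ?_
      by_cases ha' : m ≤ (a' : ℕ) + N₂
      · have hnot' : ¬ (m ≤ (a' : ℕ) + N₂ ∧ m ≤ (b : ℕ) + N₂ ∧ m ≤ (c : ℕ) + N₂) :=
          fun h => hbc h.2
        have h1 : mixT N₂ x y a' b c = x a' b c := by simp only [mixT, if_neg hnot']
        rw [h1, apply_eq_zero_of_mem_blockDiag hx (by tauto), mul_zero]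
      · rw [borel_apply_eq_zero_of_blocks hP ha ha', zero_mul]
  · simp only [extendLast_apply_of_not_mem P ha]
    rw [Finset.sum_eq_single a]
    · have hnot : ¬ (m ≤ (a : ℕ) + N₂ ∧ m ≤ (b : ℕ) + N₂ ∧ m ≤ (c : ℕ) + N₂) := fun h => ha h.1
      rw [if_pos rfl, one_mul]
      simp only [mixT, if_neg hnot]
    · intro a' _ ha'
      rw [if_neg (Ne.symm ha'), zero_mul]
    · intro h
      exact absurd (Finset.mem_univ a) h

/-- **Block-extended Borel action.**  On a block-diagonal `x`, mixing commutes with the Borel action up to block extension: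
`mixT x ((P,Q,R)·y) = (1⊕P_BB, 1⊕Q_BB, 1⊕R_BB)·(mixT x y)`. [this node] -/
theorem mixT_actTensor {N₂ : ℕ} {x : Tensor ℂ m} (hx : x ∈ blockDiag m N₂) {P Q R : Matrix (Fin m) (Fin m) ℂ}
    (hP : P ∈ borel m) (hQ : Q ∈ borel m) (hR : R ∈ borel m) (y : Tensor ℂ m) :
    mixT N₂ x (actTensor P Q R y) =
      actTensor (extendLast N₂ P) (extendLast N₂ Q) (extendLast N₂ R) (mixT N₂ x y) := by
  have h3 : ∀ (A B C : Matrix (Fin m) (Fin m) ℂ) (t : Tensor ℂ m),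
      actTensor A B C t = slotAct 0 A (slotAct 1 B (slotAct 2 C t)) := fun A B C t => by
    simp only [slotAct_zero, slotAct_one, slotAct_two, actTensor_actTensor, Matrix.mul_one, Matrix.one_mul]
  rw [h3 P Q R y, h3 (extendLast N₂ P) (extendLast N₂ Q) (extendLast N₂ R) (mixT N₂ x y),
    slotAct_two_extendLast_mixT hx hR, slotAct_one_extendLast_mixT hx hQ, slotAct_zero_extendLast_mixT hx hP]

/-! ### 3 · H13: the Levi restriction law -/

/-- **H13 (Levi restriction law).**  The restriction to the last block (size `N₂ ≤ N`, `N₂ ≤ m`) at a block-diagonal point of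
a weight vector of the corner type `((k^N))³`, degree `kN`, is a weight vector of the block type `((k^{N₂}))³`, degree `k N₂`.
[this node] -/
theorem restrictB_mem_hwvSpace {N N₂ k : ℕ} (hN : N₂ ≤ N) (hN₂m : N₂ ≤ m) {x : Tensor ℂ m}
    (hx : x ∈ blockDiag m N₂) {f : MvPolynomial (Idx m) ℂ} (hf : f ∈ hwvSpace (rectType m N k) (k * N)) :
    restrictB N₂ x f ∈ hwvSpace (rectType m N₂ k) (k * N₂) := by
  have hsemi : ∀ P Q R : Matrix (Fin m) (Fin m) ℂ, P ∈ borel m → Q ∈ borel m → R ∈ borel m →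
      ∀ y : Tensor ℂ m, evalT (actTensor P Q R y) (restrictB N₂ x f) =
        weightChar (rectType m N₂ k 0) P * weightChar (rectType m N₂ k 1) Q *
          weightChar (rectType m N₂ k 2) R * evalT y (restrictB N₂ x f) := by
    intro P Q R hP hQ hR y
    rw [evalT_restrictB, evalT_restrictB, mixT_actTensor hx hP hQ hR,
      hf.2 _ _ _ (extendLast_mem_borel hP) (extendLast_mem_borel hQ) (extendLast_mem_borel hR),
      weightChar_rectType_extendLast hN, weightChar_rectType_extendLast hN,
      weightChar_rectType_extendLast hN]
  refine ⟨?_, hsemi⟩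
  refine isHomogeneous_of_eval_smul_ne_zero _ _ fun s hs y => ?_
  have hD : (Matrix.diagonal fun _ : Fin m => s) ∈ borel m := diagonal_mem_borel fun _ => hs
  have h := hsemi _ 1 1 hD one_mem_borel one_mem_borel (fun a b c => y (a, b, c))
  rw [weightChar_one, weightChar_one, mul_one, mul_one, weightChar_rectType_scalar hN₂m,
    actTensor_scalar_one_one] at h
  rw [eval_eq_evalT, eval_eq_evalT]
  have hfun : (fun a b c : Fin m => (s • y) (a, b, c)) = fun a b e : Fin m => s * y (a, b, e) := by
    funext a b c
    rfl
  rw [hfun]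
  exact h

/-- **Levels of a block point are levels of its last block.** `E'_N(x) ⊆ E'_{N₂}(x)` for block-diagonal `x`
(the restriction `restrictB N₂ x f` is non-zero at `x` itself whenever `f(x) ≠ 0`). [this node] -/
theorem pointLevels_subset_pointLevels_last {N N₂ : ℕ} (hN : N₂ ≤ N) (hN₂m : N₂ ≤ m) {x : Tensor ℂ m}
    (hx : x ∈ blockDiag m N₂) : pointLevels N x ⊆ pointLevels N₂ x := by
  rintro k ⟨f, hf, hne⟩
  exact ⟨restrictB N₂ x f, restrictB_mem_hwvSpace hN hN₂m hx hf, by rwa [evalT_restrictB, mixT_self]⟩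

/-- **… and of the block ALONE.** `E'_N(x_out ⊞ x_B) ⊆ E'_{N₂}(x_B)` with `x_B = x|_{B³}` the cube projection. [this node] -/
theorem pointLevels_subset_pointLevels_cubeLast {N N₂ : ℕ} (hN : N₂ ≤ N) (hN₂m : N₂ ≤ m) {x : Tensor ℂ m}
    (hx : x ∈ blockDiag m N₂) : pointLevels N x ⊆ pointLevels N₂ (cubeLast N₂ x) := by
  rintro k ⟨f, hf, hne⟩
  exact ⟨restrictB N₂ x f, restrictB_mem_hwvSpace hN hN₂m hx hf, by rwa [evalT_restrictB, mixT_cubeLast]⟩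

/-- **Dead blocks.**  A level that is EMPTY at the block format `N₂` is not a level of any block-diagonal point with a last
block of size `N₂` (e.g. `N₂ = 2` at odd levels). [this node] -/
theorem not_mem_pointLevels_of_emptyLevel_last {N N₂ : ℕ} (hN : N₂ ≤ N) (hN₂m : N₂ ≤ m) {x : Tensor ℂ m}
    (hx : x ∈ blockDiag m N₂) {k : ℕ} (hk : k ∈ emptyLevels m N₂) : k ∉ pointLevels N x := by
  intro hkx
  obtain ⟨g, hg, hne⟩ := pointLevels_subset_pointLevels_last hN hN₂m hx hkx
  have hbot : hwvSpace (rectType m N₂ k) (k * N₂) = ⊥ := hk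
  rw [hbot, Submodule.mem_bot] at hg
  exact hne (by rw [hg, map_zero])

/-! ### 4 · The lifting inequality (sufficiency half) -/

/-- Padding along the identity is the identity. [bookkeeping] -/
theorem padTensor_id (t : Tensor ℂ m) : padTensor (fun i : Fin m => i) t = t := by
  funext a b c
  unfold padTensor
  rw [Finset.sum_eq_single (a, b, c)]
  · simp
  · rintro ⟨a', b', c'⟩ _ hne
    rw [if_neg, zero_mul]
    rintro ⟨rfl, rfl, rfl⟩
    exact hne rfl
  · intro h
    exact absurd (Finset.mem_univ _) h

/-- **Witness principle, corner form.** The levels of any point of rank `≤ m` pass at `m`. [this node] -/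
theorem pointLevels_subset_passLevels_of_rank_le (N : ℕ) {t : Tensor ℂ m} (hr : tensorRank t ≤ m) :
    pointLevels N t ⊆ passLevels m N := by
  have h := pointLevels_padTensor_subset_passLevels N (fun i : Fin m => i) hr
  rwa [padTensor_id] at h

/-- **Lifting inequality.**  A level of a two-block point `x + y` whose block ranks satisfy `R(x) + R(y) ≤ m` passes at `m`:
the certificate `r_N(k) ≤ R(w₁) + ⋯ + R(w_r)` of every block-point census. [this node] -/
theorem pointLevels_add_subset_passLevels (N : ℕ) {x y : Tensor ℂ m} (h : tensorRank x + tensorRank y ≤ m) :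
    pointLevels N (x + y) ⊆ passLevels m N :=
  pointLevels_subset_passLevels_of_rank_le N ((tensorRank_add_le x y).trans h)

/-! ### 5 · Windows anywhere in the corner (with the Levi–Weyl law H12) -/

/-- Simultaneous corner relabelling preserves the levels of a point (three applications of H12 (D₃)). [bookkeeping] -/
theorem pointLevels_actTensor_permMatrix (N : ℕ) (σ : Equiv.Perm (Fin m)) (hσ : ∀ a, σ a ≠ a → m ≤ (a : ℕ) + N)
    (t : Tensor ℂ m) :
    pointLevels N (actTensor (σ.permMatrix ℂ) (σ.permMatrix ℂ) (σ.permMatrix ℂ) t) = pointLevels N t := by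
  have h3 : actTensor (σ.permMatrix ℂ) (σ.permMatrix ℂ) (σ.permMatrix ℂ) t =
      slotAct 0 (σ.permMatrix ℂ) (slotAct 1 (σ.permMatrix ℂ) (slotAct 2 (σ.permMatrix ℂ) t)) := by
    simp only [slotAct_zero, slotAct_one, slotAct_two, actTensor_actTensor, Matrix.mul_one, Matrix.one_mul]
  rw [h3, pointLevels_slotAct_permMatrix N 0 σ hσ, pointLevels_slotAct_permMatrix N 1 σ hσ,
    pointLevels_slotAct_permMatrix N 2 σ hσ]

/-- **Window law.**  If a corner relabelling `σ` moves a block of `x` into last position — `σ·x` is block-diagonal for the last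
`N₂` indices — then every level of `x` is a level of that block at its own format: `E'_N(x) ⊆ E'_{N₂}((σ·x)|_{B³})`.
[this node] -/
theorem pointLevels_subset_pointLevels_window {N N₂ : ℕ} (hN : N₂ ≤ N) (hN₂m : N₂ ≤ m) (σ : Equiv.Perm (Fin m))
    (hσ : ∀ a, σ a ≠ a → m ≤ (a : ℕ) + N) {x : Tensor ℂ m}
    (hx : actTensor (σ.permMatrix ℂ) (σ.permMatrix ℂ) (σ.permMatrix ℂ) x ∈ blockDiag m N₂) :
    pointLevels N x ⊆
      pointLevels N₂ (cubeLast N₂ (actTensor (σ.permMatrix ℂ) (σ.permMatrix ℂ) (σ.permMatrix ℂ) x)) := by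
  rw [← pointLevels_actTensor_permMatrix N σ hσ x]
  exact pointLevels_subset_pointLevels_cubeLast hN hN₂m hx

/-- **Dead windows.**  A block point one of whose blocks has a size `N₂` at which level `k` is empty does not carry level `k`.
[this node] -/
theorem not_mem_pointLevels_of_emptyLevel_window {N N₂ : ℕ} (hN : N₂ ≤ N) (hN₂m : N₂ ≤ m) (σ : Equiv.Perm (Fin m))
    (hσ : ∀ a, σ a ≠ a → m ≤ (a : ℕ) + N) {x : Tensor ℂ m}
    (hx : actTensor (σ.permMatrix ℂ) (σ.permMatrix ℂ) (σ.permMatrix ℂ) x ∈ blockDiag m N₂) {k : ℕ}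
    (hk : k ∈ emptyLevels m N₂) : k ∉ pointLevels N x := by
  rw [← pointLevels_actTensor_permMatrix N σ hσ x]
  exact not_mem_pointLevels_of_emptyLevel_last hN hN₂m hx hk

end BlockRestriction

end Summit.MatrixMultiplication.MatrixMultiplication.Theorems.ObstructionCalculus
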